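import Summits.CriticalPhenomena.PercolationContinuityZ3.Theorems.PercNearOneGluingNoHeavyQuantDIBStar
import Summits.CriticalPhenomena.PercolationContinuityZ3.Theorems.PercNearOneGluingNoHeavyQuantIndepBlobExtraBlobs
import HarnessLib

/-!
# QUANT lane R8, FAR on general trees — the term certificate α′ with ANY NUMBER of light blobs: floor `≥ 1/2` and heavy
# sizes totalling `≥ 2(j − s) + 1` ⟹ `TERM ≥ x`, no credit used (lead g15's `sizeRow_with_extra_blobs`)

builds on p205010 (kernel theorem, internal audit signed; external expert review pending)

Support file (`--supports stmt-CriticalPhenomena-4575`), QUANT lane typer seat prim-quant-stmt (gen 17), rung R8 of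
`run/shared/lean/prim/quant/LADDER.md`.  Theorems only, no sorries, standard axioms.  Generalises `Quant.RootDec.term_ge_of_extraBlob`
(`…QuantDIBStarBridge`, one light blob) using `Quant.IndepBlob.sizeRow_with_extra_blobs` (`…QuantIndepBlobExtraBlobs`, lead g15,
p252105: the odd-size row survives any finset of extra blobs of arbitrary gates).

* `Quant.RootDec.term_ge_of_extraBlobs` — gates in `[0,1]`, `1/2 ≤ x ≤ 1`, and the HEAVY blobs (`x ≤ g k`) have sizes totalling
  `≥ 2(j − s) + 1`: then `x ≤ TERM[s, a, g, j]`, whatever the light blobs are.  With `term_ge_of_credit_of_le_half` (floors `≤ 1/2`)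
  this leaves to Conjecture DIB\* only the terms of its corner (`Quant.IndepBlob.DIBStarCorner`, `…QuantDIBStarCorner`): floor `> 1/2`,
  heavy total `≤ 2(j − s)`, a non-empty light blob.

[this work]; the gluing rows served [cite: KozmaNitzan2024, Conjecture 3 (p. 15)].
-/

namespace Summit.CriticalPhenomena.PercolationContinuityZ3.Theorems

namespace Quant

namespace RootDec

open Finset

variable {κ : Type} [Fintype κ] [DecidableEq κ]

/-- product-Bernoulli weight of the set `W` of open blobs (as in `…QuantRootReduction`) -/
local notation3 "wt[" g ", " W "]" => ∏ k, (if k ∈ (W : Finset κ) then (g : κ → ℝ) k else 1 - (g : κ → ℝ) k)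

/-- the TERM tail `P(s + Σ_{k open} a k ≥ j+1)` (as in `…QuantRootReduction`) -/
local notation3 "TERM[" s ", " a ", " g ", " j "]" =>
  ∑ W : Finset κ, wt[g, W] * (if (j : ℕ) + 1 ≤ (s : ℕ) + ∑ k ∈ W, (a : κ → ℕ) k then (1 : ℝ) else 0)

/-- **α′ with any number of light blobs.**  Gates in `[0,1]`, `1/2 ≤ x ≤ 1`, and `2(j − s) + 1 ≤ Σ_{k : x ≤ g k} a k` (the heavy
sizes alone reach the odd threshold): then `x ≤ TERM[s, a, g, j]` — the light blobs, of any gates and sizes, are free riders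
(`IndepBlob.sizeRow_with_extra_blobs` with the light blobs as extras and the least heavy gate as floor). [this work] -/
theorem term_ge_of_extraBlobs (s : ℕ) (a : κ → ℕ) (g : κ → ℝ) (j : ℕ) (x : ℝ) (hx : 1 / 2 ≤ x) (hx1 : x ≤ 1)
    (hg : ∀ k, 0 ≤ g k ∧ g k ≤ 1)
    (hsize : 2 * (j - s) + 1 ≤ ∑ k ∈ Finset.univ.filter (fun k => x ≤ g k), a k) : x ≤ TERM[s, a, g, j] := by
  by_cases hs : j + 1 ≤ s
  · rw [term_eq_one_of_sure s a g j hs]; exact hx1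
  have hsj : s ≤ j := by omega
  set L : Finset κ := Finset.univ.filter (fun k => g k < x) with hL
  have hmemL : ∀ k, k ∈ L ↔ g k < x := fun k => by simp [hL]
  -- a heavy blob exists
  have hne : (Finset.univ.filter (fun k => x ≤ g k)).Nonempty := by
    rcases Finset.eq_empty_or_nonempty (Finset.univ.filter (fun k => x ≤ g k)) with h0 | h0
    · rw [h0, Finset.sum_empty] at hsize; omega
    · exact h0
  obtain ⟨y₀, hy₀, hy₀min⟩ := Finset.exists_min_image _ g hne
  have hxy₀ : x ≤ g y₀ := (Finset.mem_filter.1 hy₀).2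
  have hy₀L : y₀ ∉ L := fun h' => (not_lt.2 hxy₀) ((hmemL y₀).1 h')
  have hcompl : ∀ k, k ∉ L → x ≤ g k := fun k hk => not_lt.1 fun h' => hk ((hmemL k).2 h')
  have hsplit : ∑ k, a k = ∑ k ∈ L, a k + ∑ k ∈ Finset.univ.filter (fun k => x ≤ g k), a k := by
    rw [hL, ← Finset.sum_filter_add_sum_filter_not Finset.univ (fun k => g k < x) a]
    congr 1
    refine Finset.sum_congr ?_ fun _ _ => rfl
    ext k
    simp [not_lt]
  have hsize' : 2 * (j - s) + 1 + ∑ k ∈ L, a k ≤ ∑ k, a k := by omega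
  have row := IndepBlob.sizeRow_with_extra_blobs g a (fun k => (hg k).1) (fun k => (hg k).2) L y₀ hy₀L
    (fun k hk => hy₀min k (Finset.mem_filter.2 ⟨Finset.mem_univ k, hcompl k hk⟩)) (hx.trans hxy₀) (j - s) hsize'
  rw [term_shift s a g j hsj]
  rw [Finset.sum_filter] at row
  refine hxy₀.trans (row.trans (le_of_eq (Finset.sum_congr rfl fun W _ => ?_)))
  split_ifs <;> simp

end RootDec

end Quant

end Summit.CriticalPhenomena.PercolationContinuityZ3.Theorems
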